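import Mathlib
import Summits.ValiantsHypothesis.ValiantsHypothesis.Theorems.LacunarySymmetroidMatrixDescartesCensusDefs
import Summits.ValiantsHypothesis.ValiantsHypothesis.Theorems.LacunarySymmetroidMatrixDescartesCensusFrame
import Summits.ValiantsHypothesis.ValiantsHypothesis.Theorems.LacunarySymmetroidMatrixDescartesCensusKLawBridge
import Summits.ValiantsHypothesis.ValiantsHypothesis.Theorems.KPlusLogSqLawWeakLiftingWindow
import Summits.ValiantsHypothesis.ValiantsHypothesis.Theorems.MatrixDescartes.Negative.MatrixDescartesWitness24
import Summits.ValiantsHypothesis.ValiantsHypothesis.Theses.LacunarySymmetroid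
import Summits.ValiantsHypothesis.ValiantsHypothesis.Theorems.LacunarySymmetroidMatrixDescartesFoldLawStubRungOne
import Summits.ValiantsHypothesis.ValiantsHypothesis.Theorems.LacunarySymmetroidMatrixDescartesFoldLawStubPerturb
import Summits.ValiantsHypothesis.ValiantsHypothesis.Theorems.LacunarySymmetroidMatrixDescartesFoldLawStubMorse
import Summits.ValiantsHypothesis.ValiantsHypothesis.Theorems.LacunarySymmetroidMatrixDescartesFoldLawTwoK

/-!
# val-idea-2 (g2) — LINE «definite-pair-fold-law» (crux `Theses.LacunarySymmetroid.MatrixDescartes`, stmt-18050, via Conjecture B)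

Lens: discriminant / resultant stratification.  Object: the **A₁ (fold) stratum of the projection to the
sweep axis** of the spectral curve of the SIGN-SPLIT pair.  Write a real symmetric lacunary pencil as
`F(x) = A(x) − C(x)`, `A(x) = Σ_l x^{d_l} P_l`, `C(x) = Σ_l x^{d_l} Q_l` with `P_l, Q_l ⪰ 0` (e.g. the spectral or
LDL parts of the letters; any definite pair on the same support is admissible).  When `Σ Q_l ≻ 0` and
`Σ P_l ≻ 0`, the pair `(A(x), C(x))` is DEFINITE for every `x > 0`, so `y ↦ Φ(x,y) := det(A(x) − y·C(x))` is
hyperbolic: its `m` roots `0 < y_1(x) ≤ … ≤ y_m(x)` (the generalized eigenvalues) are real, and the real curve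
`{Φ = 0} ∩ {x > 0}` is a union of `m` GRAPHS over the whole half-line (no births, no deaths, no escapes).
`det F(x₀) = 0 ⟺ some y_j(x₀) = 1`, hence by Rolle on each branch

  `Z₊(det F) ≤ m + κ(A, C)`,   `κ(A,C) = #{(x,y) : x > 0, y > 0, Φ = 0, θ_x Φ = 0}`   (`MorseInequality`),

`κ` = the number of critical points of the generalized-eigenvalue branches = the fold number of the spectral
curve over the `y`-axis (a resultant count: `Res_y(Φ, θ_xΦ)`).  A critical point of `y_j` at `x` with
eigenvector `v` is the BARYCENTRIC BALANCE `⟨θA v, v⟩·⟨C v, v⟩ = ⟨A v, v⟩·⟨θC v, v⟩`: the Gibbs mean exponent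
of the positive part along `v` equals that of the negative part.  If the supports of the two signs are
separated (`max supp⁻ < min supp⁺` after a shift) there is no balance point, `κ = 0` and `Z₊ ≤ m` — the cell's
Loewner-sector engine is the `κ = 0` case; `κ` is the integer that interpolates between it and Descartes.
The LAW of the line is the fold budget `κ(m,K) ≤ 2^{C(K + log₂² m)}` (`FoldLaw`, Conjecture-B envelope, SAME
WALL declared: it is not weaker than B).  Unlike a scale sweep of an exponent group (P1 «halving-sweep») the
sign sweep `A − yC` is hyperbolic, so the fold count has NO transient term and is exponent-robust by fiat.

Stubs (sorried): `stub_morse` (the inequality; paper-elementary: implicit function theorem + Rolle under simple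
generalized spectrum; Lean size L/XL), `stub_foldLaw` (THE LAW, open), `stub_generic` (M/L: sign split, density
of general position inside the format, persistence of alternations), `stub_perturb` (M/L: even-multiplicity
roots to alternations, format-wide), and the first rung `stub_rungOne` (m = 1: Descartes on the Wronskian
`θA·C − A·θC`, S/M).  The composition `matrixDescartes_of_stubs` is kernel-checked and concludes the crux BY
NAME through `Census.realRootLawAt_of_posRootLawAt`, `KPlusLogSqLaw.kPlusLogSqLaw_offWindow` (K = 0 corner)
and `Census.matrixDescartes_of_kPlusLogSqLaw`.  Honest framing: nothing here proves B or `MatrixDescartes`;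
VP ≠ VNP is not moved by a law candidate.
-/

set_option linter.unusedVariables false

namespace Summit.ValiantsHypothesis.ValiantsHypothesis.Cruxes.MatrixDescartes.DefinitePairFoldLaw

open Polynomial Matrix
open scoped BigOperators
open Summit.ValiantsHypothesis.ValiantsHypothesis.Theorems.LacunarySymmetroidMatrixDescartes
  (RealRootLawAt KPlusLogSqLaw)
open Summit.ValiantsHypothesis.ValiantsHypothesis.Theorems.MatrixDescartes.Negative (PosRootLawAt)
open Summit.ValiantsHypothesis.ValiantsHypothesis.Theses.LacunarySymmetroid (MatrixDescartes)

/-! ## Objects -/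

/-- `det(Σ_l x^(d l) • S l) ∈ ℝ[X]`. -/
noncomputable def pencilDet {m K : ℕ} (d : Fin K → ℕ) (S : Fin K → Matrix (Fin m) (Fin m) ℝ) : ℝ[X] :=
  (∑ l, (X : ℝ[X]) ^ d l • (S l).map Polynomial.C).det

/-- Number of DISTINCT positive roots (the currency of `PosRootLawAt`). -/
noncomputable def posRootsCard (f : ℝ[X]) : ℕ := (f.roots.toFinset.filter (fun t => 0 < t)).card

/-- The pair polynomial `Φ(x,y) = det(Σ_l x^(d l) • (P l − y • Q l))`, variables `X 0 = x`, `X 1 = y`. -/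
noncomputable def pairPoly {m K : ℕ} (d : Fin K → ℕ) (P Q : Fin K → Matrix (Fin m) (Fin m) ℝ) :
    MvPolynomial (Fin 2) ℝ :=
  (∑ l, (MvPolynomial.X (0 : Fin 2) : MvPolynomial (Fin 2) ℝ) ^ d l •
      ((P l).map (MvPolynomial.C : ℝ →+* MvPolynomial (Fin 2) ℝ)
        - (MvPolynomial.X (1 : Fin 2) : MvPolynomial (Fin 2) ℝ) •
          (Q l).map (MvPolynomial.C : ℝ →+* MvPolynomial (Fin 2) ℝ))).det

/-- Euler operator `θ_i = X_i · ∂/∂X_i`. -/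
noncomputable def euler (i : Fin 2) (p : MvPolynomial (Fin 2) ℝ) : MvPolynomial (Fin 2) ℝ :=
  MvPolynomial.X i * MvPolynomial.pderiv i p

/-- The fold set of the spectral curve `{Φ = 0}` over the `y`-axis, in the open quadrant: points with
`θ_x Φ = 0`.  Under simple generalized spectrum these are exactly the critical points `(x, y_j(x))`,
`y_j'(x) = 0`, of the generalized-eigenvalue branches of the definite pair `(A(x), C(x))`. -/
def foldSet {m K : ℕ} (d : Fin K → ℕ) (P Q : Fin K → Matrix (Fin m) (Fin m) ℝ) : Set (Fin 2 → ℝ) :=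
  {p | 0 < p 0 ∧ 0 < p 1 ∧ MvPolynomial.eval p (pairPoly d P Q) = 0 ∧
      MvPolynomial.eval p (euler 0 (pairPoly d P Q)) = 0}

/-- Admissible (definite) pair on a common support: semidefinite letters, definite sums
(so `A(x) ≻ 0` and `C(x) ≻ 0` for every `x > 0`). -/
def IsDefinitePair {m K : ℕ} (P Q : Fin K → Matrix (Fin m) (Fin m) ℝ) : Prop :=
  (∀ l, (P l).PosSemidef) ∧ (∀ l, (Q l).PosSemidef) ∧ (∑ l, P l).PosDef ∧ (∑ l, Q l).PosDef

/-- Simple generalized spectrum over `x > 0`: every real point of the curve with `x > 0` is smooth with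
`∂_y Φ ≠ 0` (no coincidence of generalized eigenvalues; codimension two, format-generic). -/
def SimpleSpectrum {m K : ℕ} (d : Fin K → ℕ) (P Q : Fin K → Matrix (Fin m) (Fin m) ℝ) : Prop :=
  ∀ p : Fin 2 → ℝ, 0 < p 0 → MvPolynomial.eval p (pairPoly d P Q) = 0 →
    MvPolynomial.eval p (MvPolynomial.pderiv 1 (pairPoly d P Q)) ≠ 0

/-! ## Statements -/

/-- **Morse inequality** (the theorem-shaped step of the line): distinct positive roots of `det(A − C)` are
at most `m` plus the number of critical points of the generalized-eigenvalue branches of `(A, C)`. -/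
def MorseInequality : Prop :=
  ∀ (m K : ℕ) (d : Fin K → ℕ) (P Q : Fin K → Matrix (Fin m) (Fin m) ℝ),
    IsDefinitePair P Q → SimpleSpectrum d P Q → (foldSet d P Q).Finite →
      posRootsCard (pencilDet d (fun l => P l - Q l)) ≤ m + (foldSet d P Q).ncard

/-- Admissible split of a symmetric pencil `S` on the support `d`: a definite pair `(P, Q)` with `S = P − Q`,
simple generalized spectrum over `x > 0` and finitely many fold points.  (The split is NOT unique: any common
PSD translate `(P_l + T_l, Q_l + T_l)` is again a split, and FAT translates carry more folds — val-idea-crit-2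
VERDICT #21: κ = 8 with `Z = 0` at `(2,3)` for a fat split whose thin split has κ = 2.  Hence the law below
bounds the BEST split, not every split.) -/
def Admissible {m K : ℕ} (d : Fin K → ℕ) (S P Q : Fin K → Matrix (Fin m) (Fin m) ℝ) : Prop :=
  IsDefinitePair P Q ∧ (∀ l, S l = P l - Q l) ∧ SimpleSpectrum d P Q ∧ (foldSet d P Q).Finite

/-- **Fold law at a format** (v2, pencil-intrinsic `κ_min` form paying VERDICT #21 (P1)): every symmetric
`(m,K)` pencil that has an admissible split at all has one with at most `B` fold points.  Vacuity-safe in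
both directions: for `S = 0`, `K = 1` or a constant exponent vector every split has constant eigenvalue
branches (infinite fold set), so NO admissible split exists and the hypothesis fails (the literal
`∀ S, ∃ split …` form would be false there for a silly reason); and the conclusion asks for ONE split, so fat
translates are irrelevant.  The thin (LDL / spectral) split of a census row, when admissible, gives an UPPER
bound for `κ_min`, which is what the located tables of the line card report. -/
def FoldLawAt (m K B : ℕ) : Prop :=
  ∀ (d : Fin K → ℕ) (S : Fin K → Matrix (Fin m) (Fin m) ℝ), (∀ l, (S l).IsSymm) →
    (∃ P Q : Fin K → Matrix (Fin m) (Fin m) ℝ, Admissible d S P Q) →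
      ∃ P Q : Fin K → Matrix (Fin m) (Fin m) ℝ, Admissible d S P Q ∧ (foldSet d P Q).ncard ≤ B

/-- **FOLD LAW** (the format-level law of this line; Conjecture-B envelope). -/
def FoldLaw : Prop := ∃ C : ℕ, ∀ m K : ℕ, FoldLawAt m K (2 ^ (C * (K + Nat.log 2 m ^ 2)))

/-- `f` has `N` strict sign alternations on `(0, ∞)`. -/
def Alternates (f : ℝ[X]) (N : ℕ) : Prop :=
  ∃ τ : Fin (N + 1) → ℝ, StrictMono τ ∧ (∀ i, 0 < τ i) ∧
    ∀ i : Fin N, f.eval (τ i.castSucc) * f.eval (τ i.succ) < 0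

/-- Alternation law at a format (the perturbation-robust currency). -/
def AltLawAt (m K B : ℕ) : Prop :=
  ∀ (d : Fin K → ℕ) (S : Fin K → Matrix (Fin m) (Fin m) ℝ), (∀ l, (S l).IsSymm) →
    ∀ N : ℕ, Alternates (pencilDet d S) N → N ≤ B

/-! ## Stubs (registered targets of the line; `sorry` only here) -/

/-- STUB 1 (paper-elementary, Lean L/XL).  `C(x) ≻ 0` makes `y ↦ Φ(x,y)` hyperbolic with `m` real roots;
under `SimpleSpectrum` the implicit function theorem makes `{Φ = 0, x > 0}` the disjoint union of `m` real
analytic graphs `y_j` over `(0,∞)` (all positive since `A(x) ≻ 0`); `det(A − C)(x) = det C(x) · Π_j (y_j(x) − 1)`,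
so the distinct positive roots are covered by the level-1 crossings of the branches, and Rolle gives
`#{y_j = 1} ≤ #{y_j' = 0} + 1` per branch; a point of `foldSet` lies on exactly one branch and is a critical
point of it (`θ_xΦ = −∂_yΦ · x y_j'` on the graph). -/
theorem stub_morse : MorseInequality :=
  -- LANDED by val-width-18050-fm1 g0 (p600312 `FoldLaw.stub_morse`, verbatim unfolded statement; helper parts
  -- p598927 StubMorseRoots / p599533 StubMorseCount / p599775 StubMorsePencil): by-name citation, δ-unfolding only.
  Theorems.LacunarySymmetroidMatrixDescartes.FoldLaw.stub_morse

/-- STUB 2 (the LAW; open; Conjecture-B strength with a named mechanism: barycentric balance points of the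
sign-split pair).  Finite at every fixed format by fewnomial theory (two equations `Φ = θ_xΦ = 0` with a
bounded number of monomials), so only located rows and asymptotic families can test it. -/
theorem stub_foldLaw : FoldLaw := by
  sorry

/-- STUB 3 (M/L, general position).  Given a symmetric pencil `S` with `N` alternations witnessed at
`τ_0 < … < τ_N`, split `S_l = P_l − Q_l` spectrally and perturb inside the format (`P_l += εI`, `Q_l += εI`
at one index, generic `ε`-small symmetric noise) to a definite pair with simple spectrum and finite fold set,
keeping the `N` strict inequalities at the `τ_i`; then IVT gives `N` distinct positive roots of the perturbed
determinant and `MorseInequality` + the fold budget bound them. -/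
theorem stub_generic (hM : MorseInequality) :
    ∀ m K B : ℕ, FoldLawAt m K B → AltLawAt m K (m + B) := by
  -- v2: perturb `S` to a generic `S'` keeping the `N` alternations; genericity gives SOME admissible split of
  -- `S'`; `FoldLawAt` returns an admissible split `(P, Q)` of the same `S'` with `κ ≤ B`; `MorseInequality` on
  -- that split bounds the distinct positive roots of `det S' = det(P − Q)` by `m + B`; IVT gives `N ≤ Z₊(S')`.
  sorry

/-- STUB 4 (M/L, even roots to alternations, format-wide).  If every symmetric `(m,K)` pencil has at most `B`
alternations then every symmetric `(m,K)` pencil has at most `2B` distinct positive roots: odd-order roots are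
alternations and persist; at an even-order root `t₀`, `det(F + s ε X^{d l₀} E)` (`E ≻ 0` generic, `s = ±1`)
acquires a sign change near `t₀` for at least one sign `s`, so one of the two perturbed pencils alternates at
least `Z_odd + Z_even / 2 ≥ Z / 2` times. -/
theorem stub_perturb : ∀ m K B : ℕ, AltLawAt m K B → PosRootLawAt m K (2 * B) :=
  -- LANDED by val-lit p4 g11 (p596855, verbatim unfolded statement): by-name citation, δ-unfolding only.
  fun m K B h => Theorems.LacunarySymmetroidMatrixDescartes.FoldLaw.stub_perturb m K B h

/-- STUB 5 = FIRST RUNG (S/M, `m = 1`).  For a definite pair of positive `K`-nomials `A = Σ p_l x^{d_l}`,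
`C = Σ q_l x^{d_l}` the fold set is `{(x, A/C) : (θA·C − A·θC)(x) = 0}` and `θA·C − A·θC` has at most `K²`
monomials, so Descartes bounds it: `κ ≤ K² − 1`.  (The line's `m = 1` reading of Descartes: roots of
`A − C` are level-1 crossings of the ratio `A/C`.)  v2 (`κ_min` form): use the admissible split supplied by
the hypothesis itself — its fold set is finite, so `θA·C − A·θC ≢ 0`, and `(x,y) ↦ x` injects the fold set
into the positive roots of that `K²`-nomial (`roots_countP_pos_le_signVariations` +
`signVariations_lt_card_support`). -/
theorem stub_rungOne : ∀ K : ℕ, FoldLawAt 1 K (K ^ 2) := by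
  -- v1 form LANDED by val-lit p4 g11 (p596879: every definite pair of scalar K-nomials with finite fold set has
  -- `ncard ≤ K²`); the v2 (`κ_min`) form follows by taking the split supplied by the hypothesis.
  intro K d S _hS hex
  obtain ⟨P, Q, hA⟩ := hex
  exact ⟨P, Q, hA, Theorems.LacunarySymmetroidMatrixDescartes.FoldLaw.stub_rungOne K d P Q hA.1 hA.2.2.1 hA.2.2.2⟩

/-- **RUNG TWO (stub credit, `m = 2`)** — `FoldLawAt 2 K (2·K⁸)` in the v2 (`κ_min`) form is a landed THEOREM:
`Theorems/LacunarySymmetroidMatrixDescartesFoldLawTwoK.lean` (`FoldTwoK.foldLawAt_two_kmin`, statement = this line's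
`FoldLawAt` unfolded verbatim; by-name citation, δ-unfolding only).  Wired by tenure g11 (desk P6 (2), 2026-08-28). -/
theorem rungTwo (K : ℕ) : FoldLawAt 2 K (2 * K ^ 8) :=
  Theorems.LacunarySymmetroidMatrixDescartes.FoldTwoK.foldLawAt_two_kmin K

/-! ## Glue (kernel-checked) -/

/-- The stubs give Conjecture B (`KPlusLogSqLaw`): fold budget ⟹ alternation budget `m + 2^{Cn}` ⟹ distinct
positive roots `≤ 2(m + 2^{Cn})` ⟹ all real roots `≤ 4(m + 2^{Cn}) + 1 ≤ 2^{C' n}` (`n = K + log₂² m ≥ 1`);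
the corner `K = 0` is the off-window theorem. -/
theorem kPlusLogSqLaw_of_stubs (hM : MorseInequality) (hF : FoldLaw)
    (hG : MorseInequality → ∀ m K B : ℕ, FoldLawAt m K B → AltLawAt m K (m + B))
    (hP : ∀ m K B : ℕ, AltLawAt m K B → PosRootLawAt m K (2 * B)) : KPlusLogSqLaw := by
  obtain ⟨C, hC⟩ := hF
  obtain ⟨C₀, hC₀⟩ := Theorems.KPlusLogSqLaw.kPlusLogSqLaw_offWindow 0
  refine ⟨C₀ + C + 6, fun m K => ?_⟩
  rcases Nat.eq_zero_or_pos K with rfl | hK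
  · have h0 := hC₀ m 0 (Or.inl (by simp))
    exact Theorems.LacunarySymmetroidMatrixDescartes.Census.realRootLawAt_mono (Nat.pow_le_pow_right (by norm_num)
      (Nat.mul_le_mul_right _ (by omega))) h0
  · set n := K + Nat.log 2 m ^ 2 with hn
    have hAlt : AltLawAt m K (m + 2 ^ (C * n)) := hG hM m K _ (hC m K)
    have hPos : PosRootLawAt m K (2 * (m + 2 ^ (C * n))) := hP m K _ hAlt
    have hReal := Theorems.LacunarySymmetroidMatrixDescartes.Census.realRootLawAt_of_posRootLawAt hPos
    refine Theorems.LacunarySymmetroidMatrixDescartes.Census.realRootLawAt_mono ?_ hReal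
    have hn1 : 1 ≤ n := by omega
    have hlog : Nat.log 2 m ≤ n := by
      have : Nat.log 2 m ≤ Nat.log 2 m ^ 2 := by
        rcases Nat.eq_zero_or_pos (Nat.log 2 m) with h | h
        · simp [h]
        · calc Nat.log 2 m = Nat.log 2 m * 1 := by ring
            _ ≤ Nat.log 2 m * Nat.log 2 m := Nat.mul_le_mul_left _ h
            _ = Nat.log 2 m ^ 2 := by ring
      omega
    have hm : m < 2 ^ (n + 1) :=
      lt_of_lt_of_le (Nat.lt_pow_succ_log_self (by norm_num) m)
        (Nat.pow_le_pow_right (by norm_num) (by omega))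
    have hA : 2 ^ (n + 1) ≤ 2 ^ ((C + 1) * n + 1) :=
      Nat.pow_le_pow_right (by norm_num) (by nlinarith)
    have hB : 2 ^ (C * n) ≤ 2 ^ ((C + 1) * n + 1) :=
      Nat.pow_le_pow_right (by norm_num) (by nlinarith)
    have h1 : 1 ≤ 2 ^ ((C + 1) * n + 1) := Nat.one_le_two_pow
    have hTop : 2 ^ ((C + 1) * n + 1 + 4) ≤ 2 ^ ((C₀ + C + 6) * n) :=
      Nat.pow_le_pow_right (by norm_num) (by nlinarith)
    have hSplit : 2 ^ ((C + 1) * n + 1 + 4) = 16 * 2 ^ ((C + 1) * n + 1) := by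
      rw [pow_add]; ring
    calc 2 * (2 * (m + 2 ^ (C * n))) + 1
        ≤ 16 * 2 ^ ((C + 1) * n + 1) := by omega
      _ = 2 ^ ((C + 1) * n + 1 + 4) := hSplit.symm
      _ ≤ 2 ^ ((C₀ + C + 6) * n) := hTop

/-- **Composition.**  The stubs imply the crux `MatrixDescartes` (stmt-18050) BY NAME. -/
theorem matrixDescartes_of_stubs : MatrixDescartes :=
  Theorems.LacunarySymmetroidMatrixDescartes.Census.matrixDescartes_of_kPlusLogSqLaw
    (kPlusLogSqLaw_of_stubs stub_morse stub_foldLaw stub_generic stub_perturb)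

end Summit.ValiantsHypothesis.ValiantsHypothesis.Cruxes.MatrixDescartes.DefinitePairFoldLaw
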